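import Summits.QuantumFields.Balaban3D.Proofs.Primitives
import HarnessLib

/-!
# `AlphaInputsT3ACv3ProfileRecord` — STRATEGY B for 2′ (design note `STRATEGY-B-adapted-class-T3-alpha1-g5.md` §B.4 «exact profile»): RECORDS WITH A
# PRESCRIBED p-FUNCTION EXIST — for every primitive-constants record `𝔠` there is a threshold `b₁` such that for every profile `(b₀, p₀)` with `b₁ ≤ b₀`,
# `3 ≤ p₀` and every bound `c` there is a record `𝔠′` with EXACTLY `𝔠′.b₀ = b₀`, `𝔠′.p₀ = p₀`, `c ≤ 𝔠′.C68`, all other primitive fields those of `𝔠`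
# (only `r₀ := (p₀ − 1)/2`, `cJ35`, `C68` are re-set) — lane `pub-balaban3d`, seat alpha-2 (g0)

WHY.  The registered 2′ text `AlphaInputsT3ACv3Rec L` (and strategy B's `DataSchemaT3ACRec L`) has the shell `∃ b₁ p₁ ∀ b₀ ≥ b₁ ∀ p₀ ≥ p₁ ∃ 𝔠, 𝔠.b₀ = b₀ ∧
𝔠.p₀ = p₀ ∧ …`: the serving run's p-function must be EXACTLY `g·b₀(1 + log g⁻¹)^{p₀}` (owner RULING g17-№1), while in `Primitives.AlphaConsts` the profile is
DERIVED — `p₀ := 2r₀ + 1` and `b₀ := √(4·max(N,1)·max(56, 8·A·K_c³/(½log L)))` with `A = Alf` affine in the free field `cJ35` (slope `1`, through `C₅`).  This file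
inverts the two definitions: `r₀ := (p₀ − 1)/2` (needs `p₀ ≥ 3` for `r₀ ≥ 1`) and `cJ35 := b₀²/(8·M·D) − A₀` with `M = 4·max(N,1)`, `D = K_c³/(½log L)`,
`A₀ = Alf − cJ35` (needs `b₀² ≥ 56·M` and `b₀² ≥ 8·M·|A₀|·D`), and bumps `C68 := max C68 c` (the window inequality (N1) ∕ NODE O's `4π ≤ C68` are then
available at the exhibited record).  STRUCTURAL BOOKKEEPING on the record only (`Kc_pos`, `exists_alphaConsts_profile`); nothing of [B10] is asserted; the
cluster-expansion DATA at the exhibited record stay displayed.  Count-neutral; nothing about d = 4, the continuum, or a mass gap.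

References: T. Bałaban, Commun. Math. Phys. 102 (1985) 255–275 [Balaban1985UV3] ((7) p.257).
-/

set_option autoImplicit false

noncomputable section

namespace Summit.QuantumFields.YangMills.Theorems

open Summit.QuantumFields.Balaban3D.Proofs.Primitives

variable {L N : ℕ}

/-- The collar-count constant `K_c` of the record is positive (`R₁ ≥ 6`, `M₁ ≥ 1`, `L ≥ 2`). [cite: Balaban1985UV3, (39)–(40) p.266] -/
theorem AlphaInputsT3AC.Kc_pos (𝔠 : AlphaConsts L N) : 0 < 𝔠.Kc := by
  have hR : 6 ≤ 𝔠.R₁ := by linarith [𝔠.R₁_ge, 𝔠.κ₀_pos]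
  have hM : (1 : ℝ) ≤ 𝔠.M₁ := by exact_mod_cast 𝔠.M₁_pos
  have hL : (1 : ℝ) ≤ L := by exact_mod_cast 𝔠.one_lt_L.le
  unfold AlphaConsts.Kc
  have h1 : 0 ≤ (𝔠.R₁ + 1) * 𝔠.M₁ := by nlinarith
  have h2 : 0 ≤ (L : ℝ) * (3 * ((𝔠.M₁ : ℝ) - 1)) := by nlinarith
  have h3 : 0 ≤ 3 * ((L : ℝ) - 1) := by nlinarith
  nlinarith

/-- **★ RECORDS WITH A PRESCRIBED p-FUNCTION EXIST BEYOND A THRESHOLD.**  For every record `𝔠` there is `b₁ ≥ 0` such that for all `b₀ ≥ b₁`, `p₀ ≥ 3`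
and every `c` there is a record `𝔠′` with `𝔠′.b₀ = b₀`, `𝔠′.p₀ = p₀`, `c ≤ 𝔠′.C68`, and `B₃`, `M₁`, `κ₀`, `R₁`, `γ`-relevant chart fields unchanged
(`𝔠′ = {𝔠 with r₀ := (p₀−1)/2, cJ35 := b₀²/(8MD) − A₀, C68 := max C68 c}`). [cite: Balaban1985UV3, (7) p.257] -/
theorem AlphaInputsT3AC.exists_alphaConsts_profile (𝔠 : AlphaConsts L N) :
    ∃ b₁ : ℝ, 0 ≤ b₁ ∧ ∀ (b₀ p₀ c : ℝ), b₁ ≤ b₀ → 3 ≤ p₀ →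
      ∃ 𝔠' : AlphaConsts L N, 𝔠'.b₀ = b₀ ∧ 𝔠'.p₀ = p₀ ∧ c ≤ 𝔠'.C68 ∧ 𝔠.C68 ≤ 𝔠'.C68 ∧
        𝔠'.B₃ = 𝔠.B₃ ∧ 𝔠'.M₁ = 𝔠.M₁ ∧ 𝔠'.κ₀ = 𝔠.κ₀ ∧ 𝔠'.R₁ = 𝔠.R₁ ∧ 𝔠'.ρ = 𝔠.ρ ∧ 𝔠'.cB = 𝔠.cB ∧ 𝔠'.C25 = 𝔠.C25 := by
  -- the constants of the `b₀`-equation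
  have hL1 : (1 : ℝ) < L := by exact_mod_cast 𝔠.one_lt_L
  have hlog : 0 < Real.log (L : ℝ) / 2 := by have := Real.log_pos hL1; linarith
  have hKc := AlphaInputsT3AC.Kc_pos 𝔠
  set M : ℝ := 4 * max (N : ℝ) 1 with hMdef
  set D : ℝ := 𝔠.Kc ^ 3 / (Real.log (L : ℝ) / 2) with hDdef
  set A₀ : ℝ := 𝔠.Alf - 𝔠.cJ35 with hA₀def
  have hM : 0 < M := by positivity
  have hD : 0 < D := by positivity
  refine ⟨Real.sqrt (M * 56) + Real.sqrt (8 * M * |A₀| * D), by positivity, fun b₀ p₀ c hb hp => ?_⟩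
  have hs56 : 0 ≤ Real.sqrt (M * 56) := Real.sqrt_nonneg _
  have hsA : 0 ≤ Real.sqrt (8 * M * |A₀| * D) := Real.sqrt_nonneg _
  have hb0 : 0 ≤ b₀ := by linarith
  have h56 : M * 56 ≤ b₀ ^ 2 := by
    have h := Real.sq_sqrt (show 0 ≤ M * 56 by positivity)
    nlinarith
  have hA : 8 * M * |A₀| * D ≤ b₀ ^ 2 := by
    have h := Real.sq_sqrt (show 0 ≤ 8 * M * |A₀| * D by positivity)
    nlinarith
  set t : ℝ := b₀ ^ 2 / (8 * M * D) - A₀ with htdef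
  have h8MD : 0 < 8 * M * D := by positivity
  have ht : 0 ≤ t := by
    have h1 : |A₀| ≤ b₀ ^ 2 / (8 * M * D) := by
      rw [le_div_iff₀ h8MD]; nlinarith
    have h2 : A₀ ≤ |A₀| := le_abs_self _
    linarith
  let 𝔠' : AlphaConsts L N :=
    { 𝔠 with
      r₀ := (p₀ - 1) / 2
      cJ35 := t
      C68 := max 𝔠.C68 c
      one_le_r₀ := by linarith
      cJ35_nonneg := ht
      C68_pos := lt_max_of_lt_left 𝔠.C68_pos }
  refine ⟨𝔠', ?_, ?_, le_max_right _ _, le_max_left _ _, rfl, rfl, rfl, rfl, rfl, rfl, rfl⟩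
  · -- the `b₀`-equation
    have hAlf' : 𝔠'.Alf = (𝔠.Cz + 𝔠.Cv) +
        (𝔠.cv * ((Real.log (2 * Real.pi) + max |Real.log 𝔠.c35| |Real.log 𝔠.a35|) / 2) + t) + 𝔠.C₆ + (|𝔠.logσ₀| + (𝔠.dimg : ℝ)) * 3 := rfl
    have hAlf : 𝔠.Alf = (𝔠.Cz + 𝔠.Cv) +
        (𝔠.cv * ((Real.log (2 * Real.pi) + max |Real.log 𝔠.c35| |Real.log 𝔠.a35|) / 2) + 𝔠.cJ35) + 𝔠.C₆ + (|𝔠.logσ₀| + (𝔠.dimg : ℝ)) * 3 := rfl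
    have hAlf'' : 𝔠'.Alf = A₀ + t := by rw [hAlf', hA₀def, hAlf]; ring
    have hKc' : 𝔠'.Kc = 𝔠.Kc := rfl
    have hb' : 𝔠'.b₀ = Real.sqrt (4 * max (N : ℝ) 1 * max 56 (8 * (𝔠'.Alf * 𝔠'.Kc ^ 3 / (Real.log (L : ℝ) / 2)))) := rfl
    rw [hb', hAlf'', hKc']
    have hAt : A₀ + t = b₀ ^ 2 / (8 * M * D) := by rw [htdef]; ring
    have hKc0 : 𝔠.Kc ≠ 0 := hKc.ne'
    have hlog0 : Real.log (L : ℝ) / 2 ≠ 0 := hlog.ne'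
    have hkey : 8 * ((A₀ + t) * 𝔠.Kc ^ 3 / (Real.log (L : ℝ) / 2)) = b₀ ^ 2 / M := by
      have hlogL : Real.log (L : ℝ) ≠ 0 := (Real.log_pos hL1).ne'
      rw [hAt, hDdef]
      field_simp
    rw [← hMdef, hkey]
    have hmax : max 56 (b₀ ^ 2 / M) = b₀ ^ 2 / M := max_eq_right (by rw [le_div_iff₀ hM]; linarith)
    rw [hmax, mul_div_cancel₀ _ hM.ne', Real.sqrt_sq hb0]
  · -- the `p₀`-equation
    show 2 * ((p₀ - 1) / 2) + 1 = p₀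
    ring

end Summit.QuantumFields.YangMills.Theorems

end
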